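import Summits.ABC.StewartYu.GenThreeEndRat
import Summits.ABC.StewartYu.NesterenkoZeroEndEll0
import Summits.ABC.StewartYu.MatveevStepData
import HarnessLib

/-!
# Cell abc-stewartyu, Gen-3 frames (cruxes `Y07Odd`/`Y07Two`): the zero estimate's END for rational
# generators WITH the exits A / B–C and the character lattice `Φ = H.chars` kept

`Summits/ABC/StewartYu/GenThreeEndExits.lean` — cell `abc-stewartyu` (HOME `run/shared/lean/pub/abc-stewartyu/`),
route `PadicPrimesKummerThird`, seat p3 (g5), F-two LEAD.  Theorems only, place-free (composition of landed
bricks).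

Two landed consumers of the named fact `Nesterenko2003_prop51` sit on either side of the frames' END:
`GenThreeVanishing.exists_obstruction_rat` (p3 V side: from the frame's Laurent identities (5.4) at the points
`(x, αˣ)` to the obstruction subgroup `H`, a `ℤ`-basis `M` of `Φ = H.chars` and the `nesterenkoH` inequality,
with `ℓ₀ = dim 𝔚 − dim(𝔚 ∩ T_H)` left symbolic) and `ZeroEnd.zeroEnd` (p4 E side: the same from a presented
`Q` and `hvan`, with Nesterenko's Lemma 5.3/5.4 bookkeeping `ℓ₀ + d₀ = r + [b ∉ span_ℚ Φ]` turning the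
inequality into EXIT A (`b ∉ span_ℚ Φ`, binomial index `r + 1 − d₀`) or EXIT B/C (`k•b = ∑ cᵢ Mᵢ`, `k ≠ 0`,
index `r − d₀`) — but forgetting `H`).  The Matveev step (`MatveevStepData.exists_matveev_step_data`,
`GenThreeStepTwo.stepTwo_of_exitC`) needs BOTH the exit-C relation AND `H.chars = closure(rows M)` (the
saturation of `Φ` is what lets the `q`-Kummer condition survive the re-basing).  `exists_exits_rat` is that
merged statement: Laurent identities in, `(H, r, M, hchars, exit A ∨ exit B/C)` out, by
`exists_obstruction_rat` ∘ `ZeroEnd.ell0_add_addDim_eq`.  `span_rat_of_exitC` / `pos_of_exitC` convert the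
exit-C relation into the `span_ℚ` membership and `0 < r` that `exists_matveev_step_data` consumes.

WHAT THIS IS NOT: no numerics (the record refutes exit A by (5.14)–(5.17) and `r = n` by Lemma 5.4); no crux
moves.

References: Yu. V. Nesterenko, LNM 1819 (2003), §5.2, Lemmas 5.2–5.4, (5.9)–(5.17).
-/

noncomputable section

open Finset
open Literature.NumberTheory.Transcendental
open Literature.NumberTheory.Transcendental.GaGm

namespace Summit.ABC.StewartYu.GenThreeEndExits

variable {m : ℕ}

/-- **The END with exits, `H` kept.**  For nonzero multiplicatively independent rationals `αⱼ`, `b` with a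
pivot `b j₀ ≠ 0`, the hyperplane `𝔚 = {∑ bⱼ wⱼ = 0}`, and the frame's Laurent identities (5.4) on
`|x| ≤ (m+1)X` to order `(m+1)S₀`: the zero estimate yields a connected algebraic subgroup `H` with
`d₀ = H.addDim ≤ 1`, a `ℤ`-basis `M` (`r ≤ m` independent rows) of `H.chars`, and EITHER exit A
(`b ∉ span`: no `k ≠ 0`, `c` with `k•b = ∑ cᵢ Mᵢ`, and
`choose(S₀ + (r+1−d₀), r+1−d₀)·(2X+1)·nesterenkoH ≤ (m+1)!·2ᵐ·D₀·∏D`) OR exit B/C (such `k, c` exist, and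
`choose(S₀ + (r−d₀), r−d₀)·(2X+1)·nesterenkoH ≤ (m+1)!·2ᵐ·D₀·∏D`).
[cite: Nesterenko2003, Prop 5.1 with Lemmas 5.2–5.3, (5.9)–(5.13)] -/
theorem exists_exits_rat (hZ : Nesterenko2003_prop51)
    (α : Fin m → ℚ) (hα : ∀ j, α j ≠ 0) (hind : ∀ μ : Fin m → ℤ, ∏ j, α j ^ μ j = 1 → μ = 0)
    (b : Fin m → ℤ) (j₀ : Fin m) (hb : b j₀ ≠ 0)
    (W : Submodule ℂ (ℂ × (Fin m → ℂ))) (hW : ∀ w, w ∈ W ↔ ∑ j, (b j : ℂ) * w.2 j = 0)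
    {ι : Type*} (I : Finset ι) (a : ι → ℕ) (κ : ι → Fin m → ℤ) (q : ι → ℂ)
    (D₀ S₀ X : ℕ) (D : Fin m → ℕ)
    (ha : ∀ i ∈ I, a i ≤ D₀) (hκ : ∀ i ∈ I, ∀ j, |κ i j| ≤ (D j : ℤ))
    (hinj : Set.InjOn (fun i => (a i, κ i)) I) {i₀ : ι} (hi₀ : i₀ ∈ I) (hq : q i₀ ≠ 0)
    (hL : ∀ x : ℤ, |x| ≤ (((m + 1) * X : ℕ) : ℤ) → ∀ (t : ℕ) (ν : Fin m → ℕ), ν j₀ = 0 →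
      t + ∑ k, ν k ≤ (m + 1) * S₀ →
      ∑ i ∈ I, q i * (((a i).descFactorial t : ℕ) : ℂ) * ((x : ℂ) * 1) ^ (a i - t) *
        (∏ k, ((b j₀ : ℂ) * (κ i k : ℂ) - (b k : ℂ) * (κ i j₀ : ℂ)) ^ ν k) *
        ∏ j, ((α j : ℂ)) ^ (x * κ i j) = 0) :
    ∃ (H : ConnAlgSubgroup m) (r : ℕ) (M : Matrix (Fin r) (Fin m) ℤ),
      r ≤ m ∧ H.addDim ≤ 1 ∧
      LinearIndependent ℤ (fun i => M i) ∧
      H.chars = AddSubgroup.closure (Set.range fun i => M i) ∧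
      (((¬ ∃ (k : ℤ) (c : Fin r → ℤ), k ≠ 0 ∧ k • b = ∑ i, c i • M i) ∧
          Nat.choose (S₀ + (r + 1 - H.addDim)) (r + 1 - H.addDim) * (2 * X + 1) *
              nesterenkoH m r H.addDim M D₀ D ≤ (m + 1).factorial * 2 ^ m * D₀ * ∏ j, D j) ∨
        ((∃ (k : ℤ) (c : Fin r → ℤ), k ≠ 0 ∧ k • b = ∑ i, c i • M i) ∧
          Nat.choose (S₀ + (r - H.addDim)) (r - H.addDim) * (2 * X + 1) *
              nesterenkoH m r H.addDim M D₀ D ≤ (m + 1).factorial * 2 ^ m * D₀ * ∏ j, D j)) := by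
  classical
  have hWb : ∀ u ∈ W, ∑ j, (b j : ℂ) * u.2 j = 0 := fun u hu => (hW u).mp hu
  obtain ⟨H, r, M, hr, hd, hM, hchars, _hdim, hineq⟩ :=
    Summit.ABC.StewartYu.GenThreeVanishing.exists_obstruction_rat hZ α hα hind b j₀ hb W hWb I a κ q
      D₀ S₀ X D ha hκ hinj hi₀ hq hL
  have hb0 : b ≠ 0 := by
    intro h0; apply hb; rw [h0]; rfl
  obtain ⟨hspan, hnspan⟩ := Summit.ABC.StewartYu.ZeroEnd.ell0_add_addDim_eq b hb0 W hW H M hM hchars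
  refine ⟨H, r, M, hr, hd, hM, hchars, ?_⟩
  by_cases hex : ∃ (k : ℤ) (c : Fin r → ℤ), k ≠ 0 ∧ k • b = ∑ i, c i • M i
  · right
    refine ⟨hex, ?_⟩
    have hℓ : Module.finrank ℂ W - Module.finrank ℂ ↥(W ⊓ H.tangent) = r - H.addDim := by
      have h := hspan hex; omega
    rw [hℓ] at hineq
    exact hineq
  · left
    refine ⟨hex, ?_⟩
    have hℓ : Module.finrank ℂ W - Module.finrank ℂ ↥(W ⊓ H.tangent) = r + 1 - H.addDim := by
      have h := hnspan hex; omega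
    rw [hℓ] at hineq
    exact hineq

/-- **Exit C in the currency of the Matveev step**: from `k•b = ∑ cᵢ Mᵢ` with `k ≠ 0` (integers) to
`b ∈ span_ℚ(rows M)`. [cite: Nesterenko2003, Lemma 5.3] -/
theorem span_rat_of_exitC {r : ℕ} (b : Fin m → ℤ) (M : Fin r → Fin m → ℤ)
    (hex : ∃ (k : ℤ) (c : Fin r → ℤ), k ≠ 0 ∧ k • b = ∑ i, c i • M i) :
    (fun j => (b j : ℚ)) ∈ Submodule.span ℚ (Set.range fun i => fun j => (M i j : ℚ)) := by
  classical
  obtain ⟨k, c, hk, hkb⟩ := hex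
  have hkq : (k : ℚ) ≠ 0 := by exact_mod_cast hk
  -- `b = ∑ (cᵢ / k) • Mᵢ` over `ℚ`
  have hbq : (fun j => (b j : ℚ)) = ∑ i, ((c i : ℚ) / k) • (fun j => (M i j : ℚ)) := by
    funext j
    have h := congrFun hkb j
    simp only [Pi.smul_apply, smul_eq_mul, Finset.sum_apply] at h
    have hq : (k : ℚ) * (b j : ℚ) = ∑ i, (c i : ℚ) * (M i j : ℚ) := by exact_mod_cast h
    simp only [Finset.sum_apply, Pi.smul_apply, smul_eq_mul]
    rw [eq_comm]
    calc ∑ i, (c i : ℚ) / k * (M i j : ℚ) = (∑ i, (c i : ℚ) * (M i j : ℚ)) / k := by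
          rw [Finset.sum_div]
          refine Finset.sum_congr rfl fun i _ => ?_
          ring
      _ = (k : ℚ) * (b j : ℚ) / k := by rw [hq]
      _ = (b j : ℚ) := by field_simp
  rw [hbq]
  exact Submodule.sum_mem _ fun i _ => Submodule.smul_mem _ _ (Submodule.subset_span ⟨i, rfl⟩)

/-- In exit C the character lattice is nontrivial: `k•b = ∑ cᵢ Mᵢ`, `k ≠ 0`, `b ≠ 0` force `0 < r`.
[cite: Nesterenko2003, Lemma 5.3] -/
theorem pos_of_exitC {r : ℕ} (b : Fin m → ℤ) (hb : b ≠ 0) (M : Fin r → Fin m → ℤ)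
    (hex : ∃ (k : ℤ) (c : Fin r → ℤ), k ≠ 0 ∧ k • b = ∑ i, c i • M i) : 0 < r := by
  by_contra hr
  have hr0 : r = 0 := by omega
  subst hr0
  obtain ⟨k, c, hk, hkb⟩ := hex
  apply hb
  funext j
  have h := congrFun hkb j
  simp only [Pi.smul_apply, smul_eq_mul, Finset.sum_apply, Finset.univ_eq_empty, Finset.sum_empty] at h
  rcases mul_eq_zero.mp h with h | h
  · exact absurd h hk
  · exact h

end Summit.ABC.StewartYu.GenThreeEndExits

end
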